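import Literature.Computability.Complexity.PolyHierarchy
import Literature.Computability.Complexity.OracleEmpty
import HarnessLib

/-!
# `PH^∅ = PH` (discharge of `PHRel_ofLanguage_empty`; proofs for `PolyHierarchy.lean`)

Sibling proof file of `PolyHierarchy.lean` (D-0014). It discharges

* `PHRel_ofLanguage_empty_holds : PHRel_ofLanguage_empty` —
  `PHRel (Oracle.ofLanguage ∅) = PH`: relativising the polynomial hierarchy to the empty oracle
  changes nothing (Baker–Gill–Solovay 1975, §1: the empty oracle gives no power, `P^∅ = P`).

The whole content is `P^∅ = P`, i.e. `PRel_empty_holds` (`OracleEmpty.lean`: a polynomial-time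
oracle algorithm run against the constant-`0` oracle is simulated by clocked iteration of its closed
one-round map). Since `PH^O = ⋃ₖ sigmaP (P^O) k` and `PH = ⋃ₖ sigmaP P k` iterate the *same* class
operators (`polyExists ∘ co`) from the base classes `P^∅` and `P` (`PolyHierarchy.lean`), the
equality of the bases propagates to every level (`SigmaPRel_empty`, `PiPRel_empty`) and to the
union. The oracle `Oracle.ofLanguage ∅` is `Oracle.empty` by definition
(`Oracle.empty := Oracle.ofLanguage 0`, and `(0 : Language Bool) = ∅`).

This file is kept separate from `PolyHierarchy.lean` so that the definitions of the hierarchy do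
not import the `FinTM2` machine toolkit used by `OracleEmpty.lean`.

## References

* T. Baker, J. Gill, R. Solovay, *Relativizations of the P =? NP question*, SIAM J. Comput. 4
  (1975) 431–442, §1 (relativised classes `P^X`, `NP^X`; the empty oracle, `P^∅ = P`,
  `NP^∅ = NP`).
* L. J. Stockmeyer, *The polynomial-time hierarchy*, Theoret. Comput. Sci. 3 (1976) 1–22, §3
  (relativised levels `Σₖᵖ,ˣ`).
* S. Homer, A. L. Selman, *Computability and Complexity Theory*, 2nd ed., Springer 2011, §8.2
  (Definition 8.5 and the display after Homework 8.14: `Σₙ^{P,∅} = Σₙ^P` for every `n`).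
-/

namespace Literature.Computability.Complexity

open _root_.Computability

/-- `Oracle.ofLanguage ∅` is the empty oracle `Oracle.empty` (definitional:
`Oracle.empty = Oracle.ofLanguage 0` and `(0 : Language Bool) = ∅`).
[Baker–Gill–Solovay 1975, §1] [cite: BakerGillSolovay1975, §1] -/
theorem Oracle.ofLanguage_empty : Oracle.ofLanguage (∅ : Set (List Bool)) = Oracle.empty :=
  rfl

/-- Every relativised level collapses to the unrelativised one over the empty oracle:
`Σₖᵖ,∅ = Σₖᵖ` (congruence of `sigmaP · k` under `P^∅ = P`, `PRel_empty_holds`); printed as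
`Σₙ^{P,∅} = Σₙ^P` in Homer–Selman. [Homer–Selman 2011, §8.2 (after Homework 8.14);
Baker–Gill–Solovay 1975, §1] [cite: HomerSelman2011, §8.2] -/
theorem SigmaPRel_empty (k : ℕ) : SigmaPRel Oracle.empty k = SigmaP k := by
  change sigmaP (PRel Oracle.empty) k = sigmaP Classes.P k
  rw [PRel_empty_holds]

/-- `Πₖᵖ,∅ = Πₖᵖ` (complements of `SigmaPRel_empty`).
[Homer–Selman 2011, §8.2; Baker–Gill–Solovay 1975, §1] [cite: HomerSelman2011, §8.2] -/
theorem PiPRel_empty (k : ℕ) : PiPRel Oracle.empty k = PiP k := by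
  change co (sigmaP (PRel Oracle.empty) k) = co (sigmaP Classes.P k)
  rw [PRel_empty_holds]

/-- `PH^∅ = PH` for the empty oracle `Oracle.empty` (union over `k` of `SigmaPRel_empty`).
[Baker–Gill–Solovay 1975, §1; Homer–Selman 2011, §8.2] [cite: BakerGillSolovay1975, §1] -/
theorem PHRel_empty : PHRel Oracle.empty = PH := by
  change (⋃ k, SigmaPRel Oracle.empty k) = ⋃ k, SigmaP k
  exact Set.iUnion_congr SigmaPRel_empty

/-- **Discharge of `PHRel_ofLanguage_empty`: `PH^∅ = PH`** — relativising the polynomial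
hierarchy to the empty oracle `Oracle.ofLanguage ∅` changes nothing (from `P^∅ = P`,
`PRel_empty_holds`, propagated through the iterated operators `Σₖ₊₁ = ∃ᵖ·co Σₖ`; level-wise
`Σₙ^{P,∅} = Σₙ^P`, Homer–Selman 2011, §8.2).
[Baker–Gill–Solovay 1975, §1; Homer–Selman 2011, §8.2] [cite: BakerGillSolovay1975, §1] -/
theorem PHRel_ofLanguage_empty_holds : PHRel_ofLanguage_empty :=
  PHRel_empty

end Literature.Computability.Complexity
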